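import Summits.Ventures.DiscreteObjects.Hadamard.Order167CentralizerFree668

/-!
# H(668): the involutions centralising an element of order 167 are NEGA, pairwise commuting as permutation pairs and
# ANTICOMMUTING as signed automorphisms — the `2`-part of the signed centraliser is `C₂`, `C₄` or `Q₈` (kernel)

Framing: lottery ticket; floor = certified bounds/negative ranges.

Cell pub-namedobj (venture DiscreteObjects), target (H), hadamard gen 21.  Continuation of `Order167CentralizerFree668`.  Let
`σ = (π, κ, d, e)` be a signed automorphism of a Hadamard matrix `H` of order `668` with `π^167 = κ^167 = 1`, `(π, κ) ≠ (1,1)`,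
and consider signed automorphisms `τ = (π', κ', d', e')` whose ROW part commutes with `π` and whose permutation pair is a
non-trivial involution (`π'² = κ'² = 1`).  Kernel statements:
* **`centralizer167_involution_nega`**: `τ` is of NEGA type — no fixed row, no fixed column, `d' (π' i) = −d' i`,
  `e' (κ' j) = −e' j`; in particular **`τ² = −I`** as a signed automorphism (`centralizer167_involution_sq_signs`)
  [involution census, gen 13: the fixed rows would form a union of `167`-orbits, `f ≡ 4 (mod 8)`, `f ≤ 332` impossible].
* **`centralizer167_involutions_commute`**: two such `τ₁, τ₂` (both parts commuting with `σ`) have COMMUTING permutation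
  pairs and `(π₁π₂)² = (κ₁κ₂)² = 1` [`(τ₁τ₂)² ∈ ⟨σ⟩` by `hadamard668_order167_centralizer_sq_mem`; conjugating by `τ₂` shows
  `(π₁π₂)² = π^c` is its own inverse, and `π` has odd order].
* **`centralizer167_involutions_anticommute`**: if moreover `(π₁, κ₁) ≠ (π₂, κ₂)` then `τ₁ τ₂ = −τ₂ τ₁`: the sign vectors
  of the two composites are opposite (`d₁ (π₂ i) · d₂ i = −(d₂ (π₁ i) · d₁ i)`, same for columns) [`τ₁τ₂` is again a nega
  involution, so `(τ₁τ₂)² = −I = τ₁² = τ₂²`].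
* **`centralizer167_involutions_le_three`**: among any four such `τ` two have the same permutation pair — at most THREE
  non-trivial involution pairs centralise `σ` [index `≤ 4`, and an involution pair congruent to another modulo `⟨σ⟩` equals it].
READING (group theory on these kernel facts, paper step): the elements of the signed centraliser `C±(σ)` whose pair is `1` or an
involution form, with `±I`, a `2`-group with the single involution `−I` and exponent `4`: it is `C₂ = {±I}`, `C₄`, or the
quaternion group `Q₈ = {±I, ±τ₁, ±τ₂, ±τ₁τ₂}`; correspondingly `|C(σ) : ±⟨σ⟩| = 1, 2, 4` and `C±(σ) ≅ C₁₆₇ × {C₂, C₄, Q₈}`.  In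
the case `Q₈` the group `Q₈ × C₁₆₇` acts regularly on the signed rows and on the signed columns, i.e. `H` is COCYCLIC over
`C₂² × C₁₆₇` with extension group `Q₈ × C₁₆₇` — the Williamson-type situation (de Launey–Flannery–Horadam; status-of-problem
remark, not used).  STRUCTURE of a hypothetical object; nothing is excluded; H(668) untouched; HITS 0/4.  Ours; no `sorry`,
no definitions, default heartbeats.
-/

namespace Summit.Ventures.DiscreteObjects.Hadamard

open Finset BigOperators Matrix

open Literature.Combinatorics.Designs.GoethalsSeidel (IsHadamardMatrix)

variable {ι : Type*} [Fintype ι] [DecidableEq ι]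

omit [Fintype ι] [DecidableEq ι] in
/-- a permutation with `π^(2c) = 1` and `π^167 = 1` has `π^c = 1` (`167` is odd: `c = 168c − 167c`) -/
lemma pow_eq_one_of_sq_pow_167 {π : Equiv.Perm ι} (hπ : π ^ 167 = 1) {c : ℕ} (h : π ^ (2 * c) = 1) : π ^ c = 1 := by
  calc π ^ c = π ^ c * (π ^ 167) ^ c := by rw [hπ, one_pow, mul_one]
    _ = (π ^ (2 * c)) ^ 84 := by rw [← pow_mul, ← pow_add, ← pow_mul]; congr 1; ring
    _ = 1 := by rw [h, one_pow]

section main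
variable {H : Matrix ι ι ℤ} (hH : IsHadamardMatrix H) (hι : Fintype.card ι = 668)
  {π κ : Equiv.Perm ι} {d e : ι → ℤ} (haut : IsSignedAut H π κ d e)
  (hπ : π ^ 167 = 1) (hκ : κ ^ 167 = 1) (hne : π ≠ 1 ∨ κ ≠ 1)
include hH hι haut hπ hκ hne

/-- **a centralising involution is NEGA**: no fixed row, no fixed column, and the signs alternate along the `2`-cycles:
`d' (π' i) = −d' i`, `e' (κ' j) = −e' j`. -/
theorem centralizer167_involution_nega {π' κ' : Equiv.Perm ι} {d' e' : ι → ℤ} (haut' : IsSignedAut H π' κ' d' e')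
    (hcπ : Commute π' π) (h2 : π' ^ 2 = 1) (h2' : κ' ^ 2 = 1) (hne' : π' ≠ 1 ∨ κ' ≠ 1) :
    ((∀ x, π' x ≠ x) ∧ (∀ y, κ' y ≠ y)) ∧ (∀ i, d' (π' i) = -d' i) ∧ (∀ j, e' (κ' j) = -e' j) := by
  have p167 : Nat.Prime 167 := by norm_num
  have h167 := hadamard668_fixedRows_167 hH hι π κ d e haut hπ hκ hne
  have hπfix : ∀ x, π x ≠ x := moved_of_card_fixed_eq_zero π h167.1
  have hdπ : 167 ∣ (univ.filter fun x => π' x = x).card := dvd_card_fixed_of_commute hcπ p167 hπ hπfix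
  obtain ⟨-, -, hcases⟩ := hadamard668_involution_census_final hH hι π' κ' d' e' haut' h2 h2' hne'
  rcases hcases with ⟨-, hmod8, h4, h332, -⟩ | ⟨h0, h0', hd, he⟩
  · exfalso
    obtain ⟨m, hm⟩ := hdπ
    rw [hm] at hmod8 h4 h332
    omega
  · exact ⟨⟨moved_of_card_fixed_eq_zero π' h0, moved_of_card_fixed_eq_zero κ' h0'⟩, hd, he⟩

/-- **`τ² = −I`** for a centralising involution: the sign vectors of `τ²` (namely `d' (π' i) · d' i` and `e' (κ' j) · e' j`,
cf. `isSignedAut_mul`) are identically `−1`. -/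
theorem centralizer167_involution_sq_signs {π' κ' : Equiv.Perm ι} {d' e' : ι → ℤ} (haut' : IsSignedAut H π' κ' d' e')
    (hcπ : Commute π' π) (h2 : π' ^ 2 = 1) (h2' : κ' ^ 2 = 1) (hne' : π' ≠ 1 ∨ κ' ≠ 1) :
    (∀ i, d' (π' i) * d' i = -1) ∧ (∀ j, e' (κ' j) * e' j = -1) := by
  obtain ⟨-, hd, he⟩ := centralizer167_involution_nega hH hι haut hπ hκ hne haut' hcπ h2 h2' hne'
  refine ⟨fun i => ?_, fun j => ?_⟩
  · rw [hd i]
    have := pm_mul_self (haut'.1 i)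
    linarith
  · rw [he j]
    have := pm_mul_self (haut'.2.1 j)
    linarith

/-- **two centralising involution pairs commute, and their product is an involution pair or trivial.** -/
theorem centralizer167_involutions_commute {π₁ κ₁ π₂ κ₂ : Equiv.Perm ι} {d₁ e₁ d₂ e₂ : ι → ℤ}
    (h₁ : IsSignedAut H π₁ κ₁ d₁ e₁) (h₂ : IsSignedAut H π₂ κ₂ d₂ e₂) (hc₁ : Commute π₁ π) (hc₁' : Commute κ₁ κ)
    (hc₂ : Commute π₂ π) (hc₂' : Commute κ₂ κ) (hi₁ : π₁ ^ 2 = 1) (hi₁' : κ₁ ^ 2 = 1) (hi₂ : π₂ ^ 2 = 1)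
    (hi₂' : κ₂ ^ 2 = 1) :
    (Commute π₁ π₂ ∧ Commute κ₁ κ₂) ∧ (π₁ * π₂) ^ 2 = 1 ∧ (κ₁ * κ₂) ^ 2 = 1 := by
  obtain ⟨c, hc, hc'⟩ := hadamard668_order167_centralizer_sq_mem hH hι haut hπ hκ hne (isSignedAut_mul h₁ h₂)
    (hc₁.mul_left hc₂) (hc₁'.mul_left hc₂')
  -- generic computations with involutions
  have comm_of : ∀ {a b : Equiv.Perm ι}, a ^ 2 = 1 → b ^ 2 = 1 → (a * b) ^ 2 = 1 → Commute a b := by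
    intro a b ha hb hab
    have ha' : a⁻¹ = a := inv_eq_of_mul_eq_one_right (by rw [← pow_two]; exact ha)
    have hb' : b⁻¹ = b := inv_eq_of_mul_eq_one_right (by rw [← pow_two]; exact hb)
    have hab' : (a * b)⁻¹ = a * b := inv_eq_of_mul_eq_one_right (by rw [← pow_two]; exact hab)
    show a * b = b * a
    rw [← hab', _root_.mul_inv_rev, ha', hb']
  -- for involutions a, b with b commuting with g: (ab)² = g^c forces g^(2c) = 1
  have key : ∀ {a b g : Equiv.Perm ι}, a ^ 2 = 1 → b ^ 2 = 1 → Commute b g → (a * b) ^ 2 = g ^ c →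
      g ^ (2 * c) = 1 := by
    intro a b g ha hb hbg h
    have ha' : a⁻¹ = a := inv_eq_of_mul_eq_one_right (by rw [← pow_two]; exact ha)
    have hb' : b⁻¹ = b := inv_eq_of_mul_eq_one_right (by rw [← pow_two]; exact hb)
    have hb2 : b * b = 1 := by rw [← pow_two]; exact hb
    -- (ba)² = b (ab)² b⁻¹ = g^c
    have h1 : (b * a) ^ 2 = g ^ c := by
      have e1 : b * a = b * (a * b) * b⁻¹ := by rw [hb', mul_assoc, mul_assoc, hb2, mul_one]
      rw [e1, conj_pow, h, (hbg.pow_right c).eq, mul_assoc, hb', hb2, mul_one]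
    -- (ba)² = ((ab)²)⁻¹
    have h2 : (b * a) ^ 2 = ((a * b) ^ 2)⁻¹ := by rw [← inv_pow, _root_.mul_inv_rev, ha', hb']
    rw [h1, h] at h2
    calc g ^ (2 * c) = g ^ c * g ^ c := by rw [two_mul, pow_add]
      _ = g ^ c * (g ^ c)⁻¹ := by rw [← h2]
      _ = 1 := mul_inv_cancel _
  have hπc : π ^ c = 1 := pow_eq_one_of_sq_pow_167 hπ (key hi₁ hi₂ hc₂ hc)
  have hκc : κ ^ c = 1 := pow_eq_one_of_sq_pow_167 hκ (key hi₁' hi₂' hc₂' hc')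
  rw [hπc] at hc
  rw [hκc] at hc'
  exact ⟨⟨comm_of hi₁ hi₂ hc, comm_of hi₁' hi₂' hc'⟩, hc, hc'⟩

/-- **distinct non-trivial centralising involution pairs ANTICOMMUTE as signed automorphisms**: the row-sign vector
`i ↦ d₁ (π₂ i) · d₂ i` of `τ₁ τ₂` is the negative of the row-sign vector `i ↦ d₂ (π₁ i) · d₁ i` of `τ₂ τ₁`, and likewise for
the column signs (the permutation pairs of the two composites coincide by `centralizer167_involutions_commute`). -/
theorem centralizer167_involutions_anticommute {π₁ κ₁ π₂ κ₂ : Equiv.Perm ι} {d₁ e₁ d₂ e₂ : ι → ℤ}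
    (h₁ : IsSignedAut H π₁ κ₁ d₁ e₁) (h₂ : IsSignedAut H π₂ κ₂ d₂ e₂) (hc₁ : Commute π₁ π) (hc₁' : Commute κ₁ κ)
    (hc₂ : Commute π₂ π) (hc₂' : Commute κ₂ κ) (hi₁ : π₁ ^ 2 = 1) (hi₁' : κ₁ ^ 2 = 1) (hi₂ : π₂ ^ 2 = 1)
    (hi₂' : κ₂ ^ 2 = 1) (hne₁ : π₁ ≠ 1 ∨ κ₁ ≠ 1) (hne₂ : π₂ ≠ 1 ∨ κ₂ ≠ 1) (hne₁₂ : π₁ ≠ π₂ ∨ κ₁ ≠ κ₂) :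
    (∀ i, d₁ (π₂ i) * d₂ i = -(d₂ (π₁ i) * d₁ i)) ∧ (∀ j, e₁ (κ₂ j) * e₂ j = -(e₂ (κ₁ j) * e₁ j)) := by
  obtain ⟨⟨hcomm, hcomm'⟩, hsq, hsq'⟩ :=
    centralizer167_involutions_commute hH hι haut hπ hκ hne h₁ h₂ hc₁ hc₁' hc₂ hc₂' hi₁ hi₁' hi₂ hi₂'
  -- the product pair is non-trivial
  have hne12 : π₁ * π₂ ≠ 1 ∨ κ₁ * κ₂ ≠ 1 := by
    rcases hne₁₂ with h | h
    · left
      intro h1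
      apply h
      calc π₁ = π₁ * (π₂ * π₂) := by rw [← pow_two, hi₂, mul_one]
        _ = (π₁ * π₂) * π₂ := by rw [mul_assoc]
        _ = π₂ := by rw [h1, one_mul]
    · right
      intro h1
      apply h
      calc κ₁ = κ₁ * (κ₂ * κ₂) := by rw [← pow_two, hi₂', mul_one]
        _ = (κ₁ * κ₂) * κ₂ := by rw [mul_assoc]
        _ = κ₂ := by rw [h1, one_mul]
  -- nega relations for τ₁, τ₂ and τ₁τ₂
  obtain ⟨-, hd₁, he₁⟩ := centralizer167_involution_nega hH hι haut hπ hκ hne h₁ hc₁ hi₁ hi₁' hne₁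
  obtain ⟨-, hd₂, he₂⟩ := centralizer167_involution_nega hH hι haut hπ hκ hne h₂ hc₂ hi₂ hi₂' hne₂
  obtain ⟨-, hd₁₂, he₁₂⟩ := centralizer167_involution_nega hH hι haut hπ hκ hne (isSignedAut_mul h₁ h₂)
    (hc₁.mul_left hc₂) hsq hsq' hne12
  refine ⟨fun i => ?_, fun j => ?_⟩
  · -- evaluate the nega relation of τ₁τ₂ at i
    have h := hd₁₂ i
    simp only [Equiv.Perm.mul_apply] at h
    -- π₂ (π₁ (π₂ i)) = π₁ i
    have e1 : π₂ (π₁ (π₂ i)) = π₁ i := by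
      rw [← Equiv.Perm.mul_apply, ← hcomm.eq, Equiv.Perm.mul_apply, ← Equiv.Perm.mul_apply π₂ π₂, ← pow_two, hi₂,
        Equiv.Perm.one_apply]
    rw [e1, hd₁ i] at h
    -- d₂ (π₁ (π₂ i)) = d₂ (π₂ (π₁ i)) = - d₂ (π₁ i)
    have e2 : π₁ (π₂ i) = π₂ (π₁ i) := by rw [← Equiv.Perm.mul_apply, hcomm.eq, Equiv.Perm.mul_apply]
    rw [e2, hd₂ (π₁ i)] at h
    have hsq1 := pm_mul_self (h₁.1 i)
    have hsq2 := pm_mul_self (h₂.1 i)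
    -- h : -d₁ i * -d₂ (π₁ i) = -(d₁ (π₂ i) * d₂ i)
    nlinarith [hsq1, hsq2, h]
  · have h := he₁₂ j
    simp only [Equiv.Perm.mul_apply] at h
    have e1 : κ₂ (κ₁ (κ₂ j)) = κ₁ j := by
      rw [← Equiv.Perm.mul_apply, ← hcomm'.eq, Equiv.Perm.mul_apply, ← Equiv.Perm.mul_apply κ₂ κ₂, ← pow_two, hi₂',
        Equiv.Perm.one_apply]
    rw [e1, he₁ j] at h
    have e2 : κ₁ (κ₂ j) = κ₂ (κ₁ j) := by rw [← Equiv.Perm.mul_apply, hcomm'.eq, Equiv.Perm.mul_apply]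
    rw [e2, he₂ (κ₁ j)] at h
    have hsq1 := pm_mul_self (h₁.2.1 j)
    have hsq2 := pm_mul_self (h₂.2.1 j)
    nlinarith [hsq1, hsq2, h]

/-- **at most three non-trivial involution pairs centralise `σ`**: among four centralising signed automorphisms with
non-trivial involution pairs, two have the same permutation pair. -/
theorem centralizer167_involutions_le_three (πs κs : Fin 4 → Equiv.Perm ι) (ds es : Fin 4 → ι → ℤ)
    (hs : ∀ i, IsSignedAut H (πs i) (κs i) (ds i) (es i)) (hcs : ∀ i, Commute (πs i) π) (hcs' : ∀ i, Commute (κs i) κ)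
    (hinv : ∀ i, πs i ^ 2 = 1 ∧ κs i ^ 2 = 1) (hnt : ∀ i, πs i ≠ 1 ∨ κs i ≠ 1) :
    ∃ i j : Fin 4, i ≠ j ∧ πs i = πs j ∧ κs i = κs j := by
  -- add the identity as a fifth element and apply the index bound
  set πs' : Fin 5 → Equiv.Perm ι := Fin.cons 1 πs with hπs'
  set κs' : Fin 5 → Equiv.Perm ι := Fin.cons 1 κs with hκs'
  set ds' : Fin 5 → ι → ℤ := Fin.cons (fun i => cyc π d i 0) ds with hds'
  set es' : Fin 5 → ι → ℤ := Fin.cons (fun j => cyc κ e j 0) es with hes'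
  have hs' : ∀ i, IsSignedAut H (πs' i) (κs' i) (ds' i) (es' i) := by
    intro i
    refine Fin.cases ?_ (fun k => ?_) i
    · have h0 := isSignedAut_pow haut 0
      rw [pow_zero, pow_zero] at h0
      simpa [hπs', hκs', hds', hes'] using h0
    · simpa [hπs', hκs', hds', hes'] using hs k
  have hcs1 : ∀ i, Commute (πs' i) π := by
    intro i; refine Fin.cases ?_ (fun k => ?_) i
    · simp [hπs']
    · simpa [hπs'] using hcs k
  have hcs1' : ∀ i, Commute (κs' i) κ := by
    intro i; refine Fin.cases ?_ (fun k => ?_) i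
    · simp [hκs']
    · simpa [hκs'] using hcs' k
  obtain ⟨i, j, hij, c, hcπ, hcκ⟩ :=
    hadamard668_order167_centralizer_index_le_four hH hι haut hπ hκ hne πs' κs' ds' es' hs' hcs1 hcs1'
  -- from πs' j = πs' i * π^c with both involution pairs (or trivial): π^(2c) = 1, so π^c = 1
  have hinv' : ∀ i, πs' i ^ 2 = 1 ∧ κs' i ^ 2 = 1 := by
    intro i; refine Fin.cases ?_ (fun k => ?_) i
    · simp [hπs', hκs']
    · simpa [hπs', hκs'] using hinv k
  have h2c : π ^ (2 * c) = 1 := by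
    have h := (hinv' j).1
    rw [hcπ, pow_two] at h
    -- (a g^c)(a g^c) = a² g^(2c) since a commutes with g
    have e1 : πs' i * π ^ c * (πs' i * π ^ c) = πs' i ^ 2 * π ^ (2 * c) := by
      rw [pow_two, two_mul, pow_add]
      have hc' := ((hcs1 i).pow_right c).eq
      calc πs' i * π ^ c * (πs' i * π ^ c) = πs' i * (π ^ c * πs' i) * π ^ c := by simp only [mul_assoc]
        _ = πs' i * (πs' i * π ^ c) * π ^ c := by rw [← hc']
        _ = πs' i * πs' i * (π ^ c * π ^ c) := by simp only [mul_assoc]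
    rw [e1, (hinv' i).1, one_mul] at h
    exact h
  have h2c' : κ ^ (2 * c) = 1 := by
    have h := (hinv' j).2
    rw [hcκ, pow_two] at h
    have e1 : κs' i * κ ^ c * (κs' i * κ ^ c) = κs' i ^ 2 * κ ^ (2 * c) := by
      rw [pow_two, two_mul, pow_add]
      have hc' := ((hcs1' i).pow_right c).eq
      calc κs' i * κ ^ c * (κs' i * κ ^ c) = κs' i * (κ ^ c * κs' i) * κ ^ c := by simp only [mul_assoc]
        _ = κs' i * (κs' i * κ ^ c) * κ ^ c := by rw [← hc']
        _ = κs' i * κs' i * (κ ^ c * κ ^ c) := by simp only [mul_assoc]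
    rw [e1, (hinv' i).2, one_mul] at h
    exact h
  rw [pow_eq_one_of_sq_pow_167 hπ h2c, mul_one] at hcπ
  rw [pow_eq_one_of_sq_pow_167 hκ h2c', mul_one] at hcκ
  -- so the two pairs are equal; an index `0` (the identity) would make the other pair trivial
  rcases Fin.eq_zero_or_eq_succ i with rfl | ⟨a, rfl⟩ <;> rcases Fin.eq_zero_or_eq_succ j with rfl | ⟨b, rfl⟩
  · exact absurd rfl hij
  · exfalso
    simp only [hπs', hκs', Fin.cons_zero, Fin.cons_succ] at hcπ hcκ
    rcases hnt b with h | h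
    · exact h hcπ
    · exact h hcκ
  · exfalso
    simp only [hπs', hκs', Fin.cons_zero, Fin.cons_succ] at hcπ hcκ
    rcases hnt a with h | h
    · exact h hcπ.symm
    · exact h hcκ.symm
  · simp only [hπs', hκs', Fin.cons_succ] at hcπ hcκ
    exact ⟨a, b, fun h => hij (by rw [h]), hcπ.symm, hcκ.symm⟩

end main

end Summit.Ventures.DiscreteObjects.Hadamard
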